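import Summits.RiemannHypothesis.RiemannHypothesis.Theorems.UniversalFactorLaguerreLift
import Mathlib.Analysis.Calculus.Deriv.Slope
import Mathlib.Analysis.Complex.RealDeriv

/-!
# RiemannHypothesis / UniversalFactor — under the loophole, zeros of `H_0` and `F_a` interlace:
a zero-free interval of `F_a` contains at most two zeros of `Ξ`

Route `RiemannHypothesis/UniversalFactor`, target `LaplaceLoophole` (stmt-RiemannHypothesis-2575), a
REAL-VARIABLE refutation criterion for the medium and narrow windows of its kill path. Let `a > 0`,
`F = F_a = deBruijnHDiv (1 + u²/a²)` (`= ∫₀^∞ Φ(u)(1+u²/a²)⁻¹cos(zu) du`, real entire of order `< 2`,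
even, with `H_0 = F − F''/a² = −(G' − aG)/a²`, `G = F' + aF`), and suppose `X(a)`: all zeros of `F` are
real. Then (Laguerre–Pólya, Hadamard-free via `LaguerrePolya.lean`):

* `UniversalFactor.re_deriv_logDeriv_le`, `UniversalFactor.strictAntiOn_re_logDeriv` — for a real
  entire `f` of order `< 2` with only real zeros (and at least one zero), `(f'/f)' < 0` on every real
  interval free of zeros of `f`, i.e. `x ↦ Re (f'/f)(x)` is strictly decreasing there (from
  `(Im z)·Im(f'/f)(z) ≤ −(Im z)²/‖z − a₀‖²`, `im_mul_im_logDeriv_le`, by differentiating in the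
  vertical direction: Cauchy–Riemann);
* **`UniversalFactor.not_three_zeros_of_zeroFree`** — under `X(a)`, if `F_a` has no zero on `[α, β]`
  then `H_0` (equivalently `Ξ(x/2)`, i.e. `ζ` on the critical line at `t = x/2`) has AT MOST TWO zeros
  in `[α, β]`: zeros of `G` in `[α, β]` are the points where `F'/F = −a` (at most one, `g` say, and
  `G'(g) = F(g)(F'/F)'(g) ≠ 0`), zeros of `H_0` are the points where `G'/G = a` (none at `g`), and
  `G'/G` is strictly decreasing on each of the at most two components of `[α, β] ∖ {g}`.

So `X(a)` is refuted by exhibiting ONE real interval on which `F_a` keeps its sign while `Ξ(x/2)` has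
three sign changes (four point evaluations of Hardy's `Z`) — no argument principle, no complex
evaluation of `F_a` is needed.  This is the form in which the band-limit mechanism of
`NarrowKernelNoGo`/`MediumKernelNoGo` (head suppression ⇒ `F_a` one-signed on stretches of several mean
spacings) contradicts the loophole.

References: E. Laguerre, Œuvres I (1898) pp. 167–180; G. Pólya, J. Schur, J. reine angew. Math. 144
(1914) (the class `𝓛𝓟`, `(f'/f)' < 0`); N. G. de Bruijn, Duke Math. J. 17 (1950) §§2–3;
B. Ja. Levin, *Distribution of zeros of entire functions* (1964), Ch. VIII.
-/

noncomputable section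

namespace Summit.RiemannHypothesis.RiemannHypothesis.Theorems

open MeasureTheory Set Filter Complex
open scoped Topology
open Literature.NumberTheory.LFunctions Literature.Analysis.Complex
open Summit.RiemannHypothesis.RiemannHypothesis.Theses

/-! ## The logarithmic derivative of a Laguerre–Pólya-type function decreases on the real axis -/

section General

variable {f : ℂ → ℂ}

/-- `f'/f` is real at real points of a real entire `f`. [folklore] -/
theorem UniversalFactor.im_logDeriv_ofReal (hf : Differentiable ℂ f) (hreal : ∀ x : ℝ, (f x).im = 0)
    (x : ℝ) : (deriv f x / f x).im = 0 := by
  rw [Complex.div_im, im_deriv_ofReal hf hreal x, hreal x]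
  ring

/-- Vertical derivative of `Im (f'/f)`: at a real point `x` with `f(x) ≠ 0`,
`d/dy Im (f'/f)(x + iy) |_{y=0} = Re (f'/f)'(x)` (Cauchy–Riemann). [folklore] -/
theorem UniversalFactor.hasDerivAt_im_logDeriv_vertical (hf : Differentiable ℂ f) {x : ℝ}
    (hx : f x ≠ 0) :
    HasDerivAt (fun y : ℝ => (deriv f ((x : ℂ) + I * y) / f ((x : ℂ) + I * y)).im)
      (deriv (fun z => deriv f z / f z) x).re 0 := by
  set φ : ℂ → ℂ := fun z => deriv f z / f z with hφ
  have hφd : DifferentiableAt ℂ φ (x : ℂ) := (hf.deriv x).div (hf x) hx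
  have h1 : HasDerivAt (fun w : ℂ => (x : ℂ) + I * w) I 0 := by
    simpa using ((hasDerivAt_id (0 : ℂ)).const_mul I).const_add (x : ℂ)
  have h2 : HasDerivAt (fun w : ℂ => φ ((x : ℂ) + I * w)) (deriv φ x * I) 0 := by
    have hφ' : HasDerivAt φ (deriv φ x) ((x : ℂ) + I * 0) := by
      rw [mul_zero, add_zero]; exact hφd.hasDerivAt
    exact hφ'.comp 0 h1
  have h3 : HasDerivAt (fun y : ℝ => φ ((x : ℂ) + I * y)) (deriv φ x * I) 0 := by
    have h2' : HasDerivAt (fun w : ℂ => φ ((x : ℂ) + I * w)) (deriv φ x * I) ((0 : ℝ) : ℂ) := by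
      rwa [Complex.ofReal_zero]
    exact h2'.comp_ofReal
  have h4 := (Complex.imCLM.hasFDerivAt.comp_hasDerivAt (0 : ℝ) h3)
  have hval : Complex.imCLM (deriv φ x * I) = (deriv φ x).re := by
    rw [Complex.imCLM_apply]; simp
  rw [hval] at h4
  exact h4

/-- **`(f'/f)' < 0` on the real axis (Laguerre–Pólya).** For `f` real entire of order `< 2` with only
real zeros and at least one zero `a₀`, at every real `x` with `f(x) ≠ 0`:
`Re (f'/f)'(x) ≤ −1/‖x − a₀‖² < 0`. (Divide `(Im z)Im(f'/f)(z) ≤ −(Im z)²/‖z − a₀‖²` by `(Im z)² > 0`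
at `z = x + iy` and let `y → 0⁺`.) [folklore] -/
theorem UniversalFactor.re_deriv_logDeriv_le (hf : Differentiable ℂ f) {ρ C : ℝ} (hρ0 : 0 ≤ ρ)
    (hρ : ρ < 2) (hgr : ∀ z, ‖f z‖ ≤ C * Real.exp (‖z‖ ^ ρ)) (hreal : ∀ x : ℝ, (f x).im = 0)
    (hzero : ∀ z, f z = 0 → z.im = 0) {a₀ : ℂ} (ha₀ : f a₀ = 0) {x : ℝ} (hx : f x ≠ 0) :
    (deriv (fun z => deriv f z / f z) x).re ≤ -(1 / ‖(x : ℂ) - a₀‖ ^ 2) := by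
  set s : ℝ → ℝ := fun y => (deriv f ((x : ℂ) + I * y) / f ((x : ℂ) + I * y)).im with hs
  have hD := UniversalFactor.hasDerivAt_im_logDeriv_vertical hf hx
  have hslope := hD.tendsto_slope_zero_right
  have hs0 : s 0 = 0 := by
    simp only [hs, Complex.ofReal_zero, mul_zero, add_zero]
    exact UniversalFactor.im_logDeriv_ofReal hf hreal x
  have hxa : (x : ℂ) - a₀ ≠ 0 := by
    intro h
    rw [sub_eq_zero] at h
    rw [h] at hx
    exact hx ha₀
  -- the comparison function
  set r : ℝ → ℝ := fun t => -(1 / ‖(x : ℂ) + I * t - a₀‖ ^ 2) with hr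
  have hrc : Tendsto r (𝓝[>] 0) (𝓝 (-(1 / ‖(x : ℂ) - a₀‖ ^ 2))) := by
    have hc : Continuous fun t : ℝ => (x : ℂ) + I * t - a₀ := by fun_prop
    have hct : ContinuousAt r 0 := by
      simp only [hr]
      refine ((continuous_const.div (hc.norm.pow 2) fun t => ?_).neg).continuousAt
      · exact pow_ne_zero 2 (norm_ne_zero_iff.2 (by
          intro h0
          have : ((x : ℂ) + I * t - a₀).im = 0 := by rw [h0]; simp
          have hare : a₀.im = 0 := hzero a₀ ha₀
          simp [hare] at this
          rw [this] at h0
          simp only [Complex.ofReal_zero, mul_zero, add_zero] at h0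
          exact hxa h0))
    have := hct.tendsto
    simp only [hr, Complex.ofReal_zero, mul_zero, add_zero] at this
    exact tendsto_nhdsWithin_of_tendsto_nhds this
  refine le_of_tendsto_of_tendsto hslope hrc ?_
  filter_upwards [self_mem_nhdsWithin] with t (ht : 0 < t)
  have h0 : (deriv f ((x : ℂ) + I * ((0 : ℝ) : ℂ)) / f ((x : ℂ) + I * ((0 : ℝ) : ℂ))).im = 0 := by
    simp only [Complex.ofReal_zero, mul_zero, add_zero]
    exact UniversalFactor.im_logDeriv_ofReal hf hreal x
  rw [zero_add, h0, sub_zero, smul_eq_mul]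
  have hz : ((x : ℂ) + I * t).im ≠ 0 := by simp [ht.ne']
  have key := im_mul_im_logDeriv_le hf hρ0 hρ hgr hreal hzero hz ha₀
  have him : ((x : ℂ) + I * t).im = t := by simp
  rw [him] at key
  have hpos : 0 < ‖(x : ℂ) + I * t - a₀‖ ^ 2 := by
    have : ((x : ℂ) + I * t - a₀) ≠ 0 := by
      intro h0'
      have h1 : ((x : ℂ) + I * t - a₀).im = 0 := by rw [h0']; simp
      have hare : a₀.im = 0 := hzero a₀ ha₀
      simp [hare] at h1
      exact ht.ne' h1
    positivity
  set N : ℝ := ‖(x : ℂ) + I * t - a₀‖ ^ 2 with hN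
  set J : ℝ := (deriv f ((x : ℂ) + I * t) / f ((x : ℂ) + I * t)).im with hJ
  show t⁻¹ * J ≤ -(1 / N)
  rw [inv_mul_le_iff₀ ht]
  have h1 : J ≤ -(t ^ 2 / N) / t := by
    rw [le_div_iff₀ ht]; linarith [key]
  calc J ≤ -(t ^ 2 / N) / t := h1
    _ = t * -(1 / N) := by field_simp

/-- **`Re (f'/f)` is strictly decreasing on zero-free real intervals** (same hypotheses).
[folklore] -/
theorem UniversalFactor.strictAntiOn_re_logDeriv (hf : Differentiable ℂ f) {ρ C : ℝ} (hρ0 : 0 ≤ ρ)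
    (hρ : ρ < 2) (hgr : ∀ z, ‖f z‖ ≤ C * Real.exp (‖z‖ ^ ρ)) (hreal : ∀ x : ℝ, (f x).im = 0)
    (hzero : ∀ z, f z = 0 → z.im = 0) {a₀ : ℂ} (ha₀ : f a₀ = 0) {α β : ℝ}
    (hne : ∀ x ∈ Icc α β, f x ≠ 0) :
    StrictAntiOn (fun x : ℝ => (deriv f x / f x).re) (Icc α β) := by
  set φ : ℂ → ℂ := fun z => deriv f z / f z with hφ
  have hφd : ∀ x : ℝ, f x ≠ 0 → DifferentiableAt ℂ φ (x : ℂ) := fun x hx =>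
    (hf.deriv x).div (hf x) hx
  have hderiv : ∀ x : ℝ, f x ≠ 0 → HasDerivAt (fun t : ℝ => (φ t).re) (deriv φ x).re x :=
    fun x hx => ((hφd x hx).hasDerivAt).real_of_complex
  refine strictAntiOn_of_deriv_neg (convex_Icc α β) ?_ ?_
  · intro x hx
    exact (hderiv x (hne x hx)).continuousAt.continuousWithinAt
  · intro x hx
    rw [interior_Icc] at hx
    have hx' : f x ≠ 0 := hne x (Ioo_subset_Icc_self hx)
    rw [(hderiv x hx').deriv]
    have h := UniversalFactor.re_deriv_logDeriv_le hf hρ0 hρ hgr hreal hzero ha₀ hx'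
    have hxa : (x : ℂ) - a₀ ≠ 0 := by
      intro h0; rw [sub_eq_zero] at h0; rw [h0] at hx'; exact hx' ha₀
    have hpos : 0 < 1 / ‖(x : ℂ) - a₀‖ ^ 2 := by positivity
    simp only [hφ] at h ⊢
    linarith

/-- On a zero-free real interval, `Re (f'/f)` takes each value at most once. [folklore] -/
theorem UniversalFactor.eq_of_re_logDeriv_eq (hf : Differentiable ℂ f) {ρ C : ℝ} (hρ0 : 0 ≤ ρ)
    (hρ : ρ < 2) (hgr : ∀ z, ‖f z‖ ≤ C * Real.exp (‖z‖ ^ ρ)) (hreal : ∀ x : ℝ, (f x).im = 0)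
    (hzero : ∀ z, f z = 0 → z.im = 0) {a₀ : ℂ} (ha₀ : f a₀ = 0) {α β : ℝ}
    (hne : ∀ x ∈ Icc α β, f x ≠ 0) {x₁ x₂ : ℝ} (h₁ : x₁ ∈ Icc α β) (h₂ : x₂ ∈ Icc α β)
    (heq : (deriv f x₁ / f x₁).re = (deriv f x₂ / f x₂).re) : x₁ = x₂ :=
  (UniversalFactor.strictAntiOn_re_logDeriv hf hρ0 hρ hgr hreal hzero ha₀ hne).injOn h₁ h₂ heq

end General

/-! ## The Laplace smoothing under the loophole -/

/-- **At most two zeros of `Ξ` on a zero-free interval of `F_a`** (under `X(a)`). Let `a > 0` and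
suppose all zeros of `F_a = deBruijnHDiv (1 + u²/a²)` are real. If `F_a ≠ 0` on `[α, β]`, then
`H_0 = ξ(1/2 + ix/2)/8` does not have three zeros `x₁ < x₂ < x₃` in `[α, β]`. [folklore] -/
theorem UniversalFactor.not_three_zeros_of_zeroFree {a : ℝ} (ha : 0 < a)
    (hX : HasOnlyRealZeros (deBruijnHDiv fun u : ℝ => 1 + u ^ 2 / a ^ 2)) {α β : ℝ}
    (hF : ∀ x ∈ Icc α β, deBruijnHDiv (fun u : ℝ => 1 + u ^ 2 / a ^ 2) x ≠ 0)
    {x₁ x₂ x₃ : ℝ} (h₁ : x₁ ∈ Icc α β) (h₃ : x₃ ∈ Icc α β) (h12 : x₁ < x₂) (h23 : x₂ < x₃)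
    (hz₁ : deBruijnH 0 x₁ = 0) (hz₂ : deBruijnH 0 x₂ = 0) (hz₃ : deBruijnH 0 x₃ = 0) : False := by
  have h₂ : x₂ ∈ Icc α β := ⟨h₁.1.trans h12.le, h23.le.trans h₃.2⟩
  set F : ℂ → ℂ := deBruijnHDiv fun u : ℝ => 1 + u ^ 2 / a ^ 2 with hFdef
  have hFd : Differentiable ℂ F := differentiable_deBruijnHDiv_laplace a
  have hFreal : ∀ x : ℝ, (F x).im = 0 := fun x => deBruijnHDiv_ofReal_im _ x
  obtain ⟨ρ, C, hρ0, hρ, hgr⟩ := UniversalFactor.exists_growth_deBruijnHDiv_laplace a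
  have hzero : ∀ z, F z = 0 → z.im = 0 := hX
  have ha0 : (a : ℂ) ≠ 0 := by exact_mod_cast ha.ne'
  have hH0ne : deBruijnH 0 0 ≠ 0 := deBruijnH_apply_zero_ne_zero 0
  -- the ODE and the intermediate function `G = F' + aF`
  have hODE : ∀ z, F z - deriv (deriv F) z / (a : ℂ) ^ 2 = deBruijnH 0 z := fun z =>
    deBruijnHDiv_laplace_sub_deriv_deriv a z
  have hFd' : Differentiable ℂ (deriv F) := hFd.deriv
  have hFd'' : Differentiable ℂ (deriv (deriv F)) := hFd'.deriv
  set G : ℂ → ℂ := fun z => deriv F z + (a : ℂ) * F z with hGdef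
  have hGd : Differentiable ℂ G := hFd'.add (hFd.const_mul _)
  have hderivG : ∀ z, deriv G z = deriv (deriv F) z + (a : ℂ) * deriv F z := fun z => by
    have h := ((hFd' z).hasDerivAt).add (((hFd z).hasDerivAt).const_mul (a : ℂ))
    exact h.deriv
  have hH : ∀ z, deBruijnH 0 z = -(deriv G z - (a : ℂ) * G z) / (a : ℂ) ^ 2 := by
    intro z
    rw [← hODE z, hderivG]
    simp only [hGdef]
    field_simp
    ring
  have hGreal : ∀ x : ℝ, (G x).im = 0 := fun x => by
    simp only [hGdef, Complex.add_im, Complex.mul_im, Complex.ofReal_re, Complex.ofReal_im,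
      zero_mul, add_zero, im_deriv_ofReal hFd hFreal x, hFreal x, mul_zero]
  -- at a zero of `H_0`: `G' = aG`
  have hzeroH : ∀ x : ℝ, deBruijnH 0 x = 0 → deriv G x = (a : ℂ) * G x := by
    intro x hx
    have h := hH x
    rw [hx] at h
    have h' := (div_eq_zero_iff.1 h.symm).resolve_right (pow_ne_zero 2 ha0)
    rw [neg_eq_zero, sub_eq_zero] at h'
    exact h'
  -- Step 0: `F` has a zero (else `F'/F` is a real constant `c`, `H_0 = (1 − c²/a²)F`, absurd)
  have hexF : ∃ a₀, F a₀ = 0 := by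
    by_contra hnone
    push Not at hnone
    set g : ℂ → ℂ := fun z => deriv F z / F z with hg
    have hgd : Differentiable ℂ g := fun z => ((hFd' z).div (hFd z) (hnone z))
    have hgim : ∀ z, (g z).im = 0 := fun z =>
      im_logDeriv_eq_zero_of_forall_ne_zero hFd hρ0 hρ hgr hFreal hnone z
    have hgc : ∀ z, g z = g 0 := fun z => UniversalFactor.apply_eq_apply_of_im_eq_zero hgd hgim z 0
    set c : ℂ := g 0 with hc
    have hF' : ∀ z, deriv F z = c * F z := fun z => by
      have := hgc z
      simp only [hg] at this
      rw [← this, div_mul_cancel₀ _ (hnone z)]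
    have hF'' : ∀ z, deriv (deriv F) z = c * (c * F z) := fun z => by
      have hfun : deriv F = fun z => c * F z := funext hF'
      rw [hfun, deriv_const_mul _ (hFd z), hF']
    have hHc : ∀ z, deBruijnH 0 z = (1 - c ^ 2 / (a : ℂ) ^ 2) * F z := fun z => by
      rw [← hODE z, hF'' z]; ring
    have hx₁ := hHc x₁
    rw [hz₁] at hx₁
    rcases mul_eq_zero.1 hx₁.symm with h | h
    · apply hH0ne
      rw [hHc, h, zero_mul]
    · exact hF x₁ h₁ h
  obtain ⟨a₀, ha₀⟩ := hexF
  -- Step 1: `F'/F` strictly decreasing on `[α, β]`; zeros of `G` there are where `F'/F = −a`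
  have hGzeroF : ∀ x : ℝ, x ∈ Icc α β → G x = 0 → (deriv F x / F x).re = -a := by
    intro x hx hGx
    have hFx := hF x hx
    have : deriv F x = -(a : ℂ) * F x := by
      have h0 : deriv F x + (a : ℂ) * F x = 0 := hGx
      linear_combination h0
    rw [this, mul_div_assoc, div_self hFx, mul_one]
    simp
  have hGatMostOne : ∀ x y : ℝ, x ∈ Icc α β → y ∈ Icc α β → G x = 0 → G y = 0 → x = y :=
    fun x y hx hy hGx hGy =>
      UniversalFactor.eq_of_re_logDeriv_eq hFd hρ0 hρ hgr hFreal hzero ha₀ hF hx hy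
        ((hGzeroF x hx hGx).trans (hGzeroF y hy hGy).symm)
  -- Step 2: at a zero of `H_0` in `[α, β]`, `G ≠ 0` (else `G' = 0`, but `G' = F·(F'/F)' ≠ 0`)
  have hGne : ∀ x : ℝ, x ∈ Icc α β → deBruijnH 0 x = 0 → G x ≠ 0 := by
    intro x hx hHx hGx
    have hFx := hF x hx
    have hG'0 : deriv G x = 0 := by rw [hzeroH x hHx, hGx, mul_zero]
    have hF'x : deriv F x = -(a : ℂ) * F x := by
      have h0 : deriv F x + (a : ℂ) * F x = 0 := hGx
      linear_combination h0
    -- `(F'/F)'(x) = (F''F − F'²)/F² = (F'' − a²F)/F = G'(x)/F(x) = 0`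
    have hq : deriv (fun z => deriv F z / F z) x =
        (deriv (deriv F) x * F x - deriv F x * deriv F x) / (F x) ^ 2 :=
      deriv_div (hFd' x) (hFd x) hFx
    have hG'x : deriv G x = deriv (deriv F) x - (a : ℂ) ^ 2 * F x := by
      rw [hderivG, hF'x]; ring
    have hq0 : deriv (fun z => deriv F z / F z) x = 0 := by
      rw [hq, hF'x]
      have : deriv (deriv F) x * F x - -(a : ℂ) * F x * (-(a : ℂ) * F x) =
          (deriv (deriv F) x - (a : ℂ) ^ 2 * F x) * F x := by ring
      rw [this, ← hG'x, hG'0, zero_mul, zero_div]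
    have hlt := UniversalFactor.re_deriv_logDeriv_le hFd hρ0 hρ hgr hFreal hzero ha₀ hFx
    rw [hq0, Complex.zero_re] at hlt
    have hxa : (x : ℂ) - a₀ ≠ 0 := by
      intro h0; rw [sub_eq_zero] at h0; rw [h0] at hFx; exact hFx ha₀
    have hpos : 0 < 1 / ‖(x : ℂ) - a₀‖ ^ 2 := by positivity
    linarith
  -- Step 3: `G` is real entire of order `< 2` with only real zeros and has a zero
  obtain ⟨ρ', C', hρ'0, hρ', hgr'⟩ := UniversalFactor.exists_growth_deriv_add_mul hFd hρ0 hρ hgr (a : ℂ)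
  have hGzero : ∀ z, G z = 0 → z.im = 0 := by
    rcases UniversalFactor.laguerre_step hFd hρ0 hρ hgr hFreal hzero a with hG0 | hGz
    · exfalso
      exact hGne x₁ h₁ hz₁ (hG0 x₁)
    · exact hGz
  have hexG : ∃ b₀, G b₀ = 0 := by
    by_contra hnone
    push Not at hnone
    set g : ℂ → ℂ := fun z => deriv G z / G z with hg
    have hgd : Differentiable ℂ g := fun z => ((hGd.deriv z).div (hGd z) (hnone z))
    have hgim : ∀ z, (g z).im = 0 := fun z =>
      im_logDeriv_eq_zero_of_forall_ne_zero hGd hρ'0 hρ' hgr' hGreal hnone z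
    have hgc : ∀ z, g z = g x₁ := fun z =>
      UniversalFactor.apply_eq_apply_of_im_eq_zero hgd hgim z x₁
    have hgx₁ : g x₁ = a := by
      simp only [hg]
      rw [hzeroH x₁ hz₁, mul_div_assoc, div_self (hnone _), mul_one]
    have hG' : ∀ z, deriv G z = (a : ℂ) * G z := fun z => by
      have := hgc z
      rw [hgx₁] at this
      simp only [hg] at this
      rw [← this, div_mul_cancel₀ _ (hnone z)]
    apply hH0ne
    rw [hH, hG', sub_self, neg_zero, zero_div]
  obtain ⟨b₀, hb₀⟩ := hexG
  -- Step 4: at the three zeros `G'/G = a`; on a `G`-zero-free subinterval this happens at most once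
  have hψG : ∀ x : ℝ, x ∈ Icc α β → deBruijnH 0 x = 0 → (deriv G x / G x).re = a := by
    intro x hx hHx
    rw [hzeroH x hHx, mul_div_assoc, div_self (hGne x hx hHx), mul_one]
    simp
  have hpair : ∀ y₁ y₂ : ℝ, y₁ ∈ Icc α β → y₂ ∈ Icc α β → y₁ < y₂ →
      deBruijnH 0 y₁ = 0 → deBruijnH 0 y₂ = 0 → (∀ x ∈ Icc y₁ y₂, G x ≠ 0) → False := by
    intro y₁ y₂ hy₁ hy₂ hlt hH₁ hH₂ hGI
    have heq := UniversalFactor.eq_of_re_logDeriv_eq hGd hρ'0 hρ' hgr' hGreal hGzero hb₀ hGI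
      (left_mem_Icc.2 hlt.le) (right_mem_Icc.2 hlt.le) ((hψG y₁ hy₁ hH₁).trans (hψG y₂ hy₂ hH₂).symm)
    exact hlt.ne heq
  -- Step 5: the case split on where the (at most one) zero of `G` in `[α, β]` lies
  by_cases hg12 : ∀ x ∈ Icc x₁ x₂, G x ≠ 0
  · exact hpair x₁ x₂ h₁ h₂ h12 hz₁ hz₂ hg12
  · push Not at hg12
    obtain ⟨g, hgI, hGg⟩ := hg12
    have hgαβ : g ∈ Icc α β := ⟨h₁.1.trans hgI.1, hgI.2.trans h₂.2⟩
    refine hpair x₂ x₃ h₂ h₃ h23 hz₂ hz₃ fun x hx hGx => ?_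
    have hxαβ : x ∈ Icc α β := ⟨h₂.1.trans hx.1, hx.2.trans h₃.2⟩
    have hgx : g = x := hGatMostOne g x hgαβ hxαβ hGg hGx
    -- then `g = x ≥ x₂ ≥ g`, so `g = x₂`, contradicting `G(x₂) ≠ 0`
    have hgx₂ : g = x₂ := le_antisymm hgI.2 (hgx ▸ hx.1)
    exact hGne x₂ h₂ hz₂ (hgx₂ ▸ hGg)

end Summit.RiemannHypothesis.RiemannHypothesis.Theorems
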